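import Summits.BirchSwinnertonDyer.BirchSwinnertonDyer.Theorems.AdditiveBranchIMCGenusKolyvaginPointsR
import Summits.BirchSwinnertonDyer.BirchSwinnertonDyer.Theorems.ClassRecordThreeCornerAtThreeShimuraWalkDefs
import Summits.BirchSwinnertonDyer.BirchSwinnertonDyer.Theorems.ErratumRoadFiveEulerHalfGenusTransportSign
import Literature.NumberTheory.QuadraticFields.RingClassNumberFormula
import HarnessLib

/-!
# ErratumRoadFive ∕ EulerHalf ∕ genus line — THE GENUS FAMILY CARRIES W's OWN PRINTED LABELS `ShimuraWalk.LabelsAt` (helper, `--supports 23444`)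

Cell bsd-stepL, seat bsd-idea-9 g26 (planner; line owner `genus` on the aside item `stmt-BirchSwinnertonDyer-23444`,
RULING 96 (ii)).  Piece F.5 (i)+(ii) of the gen-5 design memo (`Cruxes/EulerHalfNotRamNoInertSetAtFive/Lines/genus_gen5_design.md`
@e3f44af6a6bf): the label half of the hardest genus child `GenusLine.GenusClassDataSupply`.

WHAT.  In the presentation of bsd-addord's `GenusKolyvagin.genusKolyvaginPointsR_of_facts` (`W = C₂ • (D • E′)^{(d₁)}`, genus field
`K`, `d₁ ∣ d_K`, Birch datum `(Dt, β)` for `E′`, root `θ = √d₁ ∈ K[1]` with genus signs `s`, conductor-one point `y`, transported genus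
point `P ∈ W(K)`), the Jacobi-signed transported family `Y m := Θ_{χ(m)θ}(y_{E′}(m))` (VERBATIM loc. cit. §§1–4) satisfies THE FULL
PREDICATE `ShimuraWalk.LabelsAt W N_W K ι P Y ε` of the class-record-three Shimura walk (ε, (B2), (B3), (B3₀), (B4) with `W`'s own `a_ℓ`,
(B5) with the `ℓ`-power Frobenius) — not merely its Kolyvagin-guarded form consumed by K4e′ there — PROVIDED no inert prime off `N_W`
is `2` (`h2`; automatic when `2 ∣ N_W` or `d_K ≢ 5 (mod 8)`; the per-level label theorems `label_B4_level` ∕ `label_B5_level` carry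
`ℓ ≠ 2`), AND every CM point at a level `c` coprime to `N_{E′}`, transported along ANY root `ϑ′` of `d₁` in `K[c]`, is `± Y c`
(`genusTransport_eq_or_eq_neg`).  This is the input `GenusLine.GenusLabelsSupply` of the line's Defs III up to the frame bookkeeping,
and it feeds the datum-generic class theorems of cell bsd-stepL (`…ShimuraFamilyH47Orders` [J] 4.7, `…FamilyTransverse`,
`…FamilyStringent`, `…FamilyInvariance`) BY NAME.

PROOF = loc. cit. §§0–8 verbatim (family, pin, sign, (B3) at all levels, (B2), (B3₀)) with the level bookkeeping of §5 re-derived from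
the UNGUARDED level condition «every prime factor inert and prime to `N_W`» (inert odd `ℓ` ⟹ `(d_K/ℓ) = −1` ⟹ `ℓ ∤ d_K ⊇ d₁`:
`RingClass.isPrime_span_natCast_iff_jacobiSym_eq_neg_one`), then (B4) `label_B4_level`, (B5) `label_B5_level` per level.

HONEST FRAMING: conditional on the three named printed facts (G1) `phi_heegnerPointOfConductor_mem_range_map_ringClassField_birch`,
(B5) `Nekovar2007.cmPoint_frobeniusCongruence`, (B3) `GrossLMS1991.prop53_conj_pinned_birch` (hypotheses, as loc. cit.); no crux and
no stub is closed; `EulerHalfPOnlyMultPotMultTwinAtFive` is not proved; BSD is proved for no curve.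
[cite: GrossLMS1991, §3 Prop. 3.7, §5 Prop. 5.3] [cite: Nekovar2007, Prop. 4.9] [cite: Darmon2004, Thm. 3.6] [cite: Cox2013, §5.B Prop. 5.16]
presearch: labels of the genus family → in-tree (`label_B2…B5_level`, bsd-addord); inert ⟹ ∤ d_K → [corpus: Cox2013 Prop. 5.16] typed as
`RingClass.isPrime_span_natCast_iff_jacobiSym_eq_neg_one`; no new literature.
-/

noncomputable section

open scoped Classical ComplexConjugate

set_option linter.dupNamespace false
set_option autoImplicit false
set_option maxHeartbeats 800000

namespace Summit.BirchSwinnertonDyer.BirchSwinnertonDyer.Theorems.GenusLine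

open WeierstrassCurve NumberField Field IsDedekindDomain Literature.NumberTheory.EllipticCurves
  Literature.NumberTheory.EllipticCurves.ModularForms
  Summit.BirchSwinnertonDyer.Rank1Residual.X11b
  Summit.BirchSwinnertonDyer.BirchSwinnertonDyer.Theorems.GenusKolyvagin

variable {K : Type} [Field K] [NumberField K]

/-- An ODD prime that stays prime in the quadratic field `K` does not divide `d_K` (Cox Prop. 5.16: inert iff `(d_K/ℓ) = −1`,
and `(d_K/ℓ) = 0` when `ℓ ∣ d_K`). [cite: Cox2013, §5.B Prop. 5.16] -/
theorem not_dvd_discr_of_isPrime_span (hK2 : Module.finrank ℚ K = 2) {ℓ : ℕ} (hℓ : ℓ.Prime) (hℓ2 : ℓ ≠ 2)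
    (hinert : (Ideal.span {(ℓ : 𝓞 K)}).IsPrime) : ¬ (ℓ : ℤ) ∣ NumberField.discr K := by
  intro hdvd
  haveI := Fact.mk hℓ
  have hj := (Literature.NumberTheory.QuadraticFields.RingClass.isPrime_span_natCast_iff_jacobiSym_eq_neg_one
    hK2 hℓ hℓ2).mp hinert
  have h0 : legendreSym ℓ (NumberField.discr K) = 0 :=
    (legendreSym.eq_zero_iff ℓ (NumberField.discr K)).mpr
      ((ZMod.intCast_zmod_eq_zero_iff_dvd (NumberField.discr K) ℓ).mpr hdvd)
  rw [jacobiSym.legendreSym.to_jacobiSym] at h0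
  rw [h0] at hj
  exact absurd hj (by decide)

/-- **THE GENUS FAMILY CARRIES `W`'s OWN LABELS** — see the module docstring. [cite: GrossLMS1991, §3 Prop. 3.7, §5 Prop. 5.3]
[cite: Nekovar2007, Prop. 4.9] [cite: Darmon2004, Thm. 3.6] -/
theorem genusLabelsAt_of_facts
    (hG1 : ∀ (N : ℕ) [NeZero N] (W : WeierstrassCurve ℚ) (K : Type) [Field K] [NumberField K],
      phi_heegnerPointOfConductor_mem_range_map_ringClassField_birch N W K)
    (hNek : Nekovar2007.cmPoint_frobeniusCongruence)
    (hP53 : ∀ (N : ℕ) [NeZero N] (W : WeierstrassCurve ℚ) (K : Type) [Field K] [NumberField K],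
      GrossLMS1991.prop53_conj_pinned_birch N W K)
    (hK : IsImaginaryQuadratic K) (hD4 : NumberField.discr K < -4) (ι : K →+* ℂ)
    (E' : WeierstrassCurve ℚ) [E'.IsElliptic] [E'.IsGloballyMinimal] [NeZero (E'.conductorNorm ℤ)]
    (D C₂ : VariableChange ℚ) [(D • E').IsCharNeTwoNF] (d₁ : ℤ)
    [(C₂ • (D • E').quadraticTwist (d₁ : ℚ)).IsElliptic] [(C₂ • (D • E').quadraticTwist (d₁ : ℚ)).IsGloballyMinimal]
    (hE' : ∃ C : VariableChange ℚ, C • (C₂ • (D • E').quadraticTwist (d₁ : ℚ)).quadraticTwist (d₁ : ℚ) = E')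
    (hd₁ : d₁ ∣ NumberField.discr K)
    (Dt : ModularParametrizationData E' (E'.conductorNorm ℤ)) {β : ℤ}
    (hβ : (4 * (E'.conductorNorm ℤ : ℤ)) ∣ β ^ 2 - NumberField.discr K)
    {θ : ringClassField K ι 1} (hθ2 : θ ^ 2 = algebraMap ℚ (ringClassField K ι 1) (d₁ : ℚ)) (hθ0 : θ ≠ 0)
    (s : ringClassGal ι 1 → ℤˣ)
    (hθσ : ∀ σ : ringClassGal ι 1, σ.1 θ = ((s σ : ℤ) : ringClassField K ι 1) * θ)
    {y : (E'.baseChange (ringClassField K ι 1)).toAffine.Point}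
    (hy : Affine.Point.map (ringClassField K ι 1).subtype.toRatAlgHom y =
      heegnerPointComplexOfConductor Dt (NumberField.discr K) β 1)
    {instF : Fintype (ringClassGal ι 1)}
    {P : ((C₂ • (D • E').quadraticTwist (d₁ : ℚ)).baseChange K).toAffine.Point}
    (hP : Affine.Point.map (algebraMap K (ringClassField K ι 1)).toRatAlgHom P =
      (VariableChange.pointEquivBaseChange ((D • E').quadraticTwist (d₁ : ℚ)) C₂ (ringClassField K ι 1)
          ((VariableChange.pointEquiv (((D • E').quadraticTwist (d₁ : ℚ)).baseChange (ringClassField K ι 1)) (untwistAt hθ0)).symm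
            ((Affine.Point.congrEquiv (untwistAt_smul_eq (D • E') hθ2 hθ0)).symm
              (VariableChange.pointEquivBaseChange E' D (ringClassField K ι 1) (∑ τ : ringClassGal ι 1, (s τ : ℤ) • pointGalHom E' (ringClassField K ι 1) τ.1 y))))))
    (h2 : ∀ ℓ : ℕ, ℓ.Prime → (Ideal.span {(ℓ : 𝓞 K)}).IsPrime →
      ¬ ℓ ∣ (C₂ • (D • E').quadraticTwist (d₁ : ℚ)).conductorNorm ℤ → ℓ ≠ 2) :
    ∃ (ys : (m : ℕ) → ((C₂ • (D • E').quadraticTwist (d₁ : ℚ)).baseChange (ringClassField K ι m)).toAffine.Point) (ε : ℤ),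
      ShimuraWalk.LabelsAt (C₂ • (D • E').quadraticTwist (d₁ : ℚ)) ((C₂ • (D • E').quadraticTwist (d₁ : ℚ)).conductorNorm ℤ)
        K ι P ys ε ∧
      ∀ (c : ℕ) (hc : c ≠ 0), c.Coprime (E'.conductorNorm ℤ) →
        ∀ {ϑ' : ringClassField K ι c} (hϑ'2 : ϑ' ^ 2 = algebraMap ℚ (ringClassField K ι c) (d₁ : ℚ)) (hϑ'0 : ϑ' ≠ 0)
          {y' : (E'.baseChange (ringClassField K ι c)).toAffine.Point},
          Affine.Point.map (ringClassField K ι c).subtype.toRatAlgHom y' =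
            heegnerPointComplexOfConductor Dt (NumberField.discr K) β c →
          VariableChange.pointEquivBaseChange ((D • E').quadraticTwist (d₁ : ℚ)) C₂ (ringClassField K ι c)
              ((VariableChange.pointEquiv (((D • E').quadraticTwist (d₁ : ℚ)).baseChange (ringClassField K ι c)) (untwistAt hϑ'0)).symm
                ((Affine.Point.congrEquiv (untwistAt_smul_eq (D • E') hϑ'2 hϑ'0)).symm
                  (VariableChange.pointEquivBaseChange E' D (ringClassField K ι c) y'))) = ys c ∨
          VariableChange.pointEquivBaseChange ((D • E').quadraticTwist (d₁ : ℚ)) C₂ (ringClassField K ι c)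
              ((VariableChange.pointEquiv (((D • E').quadraticTwist (d₁ : ℚ)).baseChange (ringClassField K ι c)) (untwistAt hϑ'0)).symm
                ((Affine.Point.congrEquiv (untwistAt_smul_eq (D • E') hϑ'2 hϑ'0)).symm
                  (VariableChange.pointEquivBaseChange E' D (ringClassField K ι c) y'))) = - ys c := by
  -- §0 basic data
  haveI : NeZero ((C₂ • (D • E').quadraticTwist (d₁ : ℚ)).conductorNorm ℤ) :=
    ⟨(WeierstrassCurve.conductorNorm_pos_holds _).ne'⟩
  have hd10 : d₁ ≠ 0 := by
    rintro rfl
    apply hθ0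
    have : θ ^ 2 = 0 := by rw [hθ2]; simp
    exact pow_eq_zero_iff (n := 2) (by norm_num) |>.mp this
  -- §1 the `E′` points over `x(m)` (named fact G1) — `0` off the coprime levels
  have hex : ∀ m : ℕ, m ≠ 0 → m.Coprime (E'.conductorNorm ℤ) →
      ∃ Q : (E'.baseChange (ringClassField K ι m)).toAffine.Point,
        Affine.Point.map (ringClassField K ι m).subtype.toRatAlgHom Q =
          heegnerPointComplexOfConductor Dt (NumberField.discr K) β m :=
    fun m hm hmN => hG1 (E'.conductorNorm ℤ) E' K hK Dt β ι m hβ hm hmN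
  obtain ⟨yE, hyEdef⟩ : ∃ yE : (m : ℕ) → (E'.baseChange (ringClassField K ι m)).toAffine.Point, ∀ m,
      yE m = if h : m ≠ 0 ∧ m.Coprime (E'.conductorNorm ℤ) then (hex m h.1 h.2).choose else 0 :=
    ⟨fun m => if h : m ≠ 0 ∧ m.Coprime (E'.conductorNorm ℤ) then (hex m h.1 h.2).choose else 0, fun _ => rfl⟩
  have hyE : ∀ m (hm : m ≠ 0) (hmN : m.Coprime (E'.conductorNorm ℤ)),
      Affine.Point.map (ringClassField K ι m).subtype.toRatAlgHom (yE m) =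
        heegnerPointComplexOfConductor Dt (NumberField.discr K) β m := by
    intro m hm hmN
    rw [hyEdef m, dif_pos (And.intro hm hmN)]
    exact (hex m hm hmN).choose_spec
  have hyE0 : ∀ m, ¬ (m ≠ 0 ∧ m.Coprime (E'.conductorNorm ℤ)) → yE m = 0 := fun m h => by
    rw [hyEdef m, dif_neg h]
  -- §2 the pin of Prop. 5.3 and the sign `ε`
  obtain ⟨σ₁, hσ₁, H53⟩ := hP53 (E'.conductorNorm ℤ) E' K hK Dt β ι hβ
  set u₁ : ℤ := (s ⟨σ₁, hσ₁⟩ : ℤ) with hu₁def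
  have hu₁ : u₁ = 1 ∨ u₁ = -1 := by
    rcases Int.units_eq_one_or (s ⟨σ₁, hσ₁⟩) with h | h
    · left; rw [hu₁def, h]; rfl
    · right; rw [hu₁def, h]; rfl
  have hσ₁θ : σ₁ θ = ((u₁ : ℤ) : ringClassField K ι 1) * θ := hθσ ⟨σ₁, hσ₁⟩
  set uτ : ℤ := Int.sign d₁ with huτdef
  have huτ : uτ = 1 ∨ uτ = -1 := by
    rcases lt_or_gt_of_ne hd10 with h | h
    · right; exact Int.sign_eq_neg_one_of_neg h
    · left; exact Int.sign_eq_one_of_pos h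
  set ε : ℤ := -E'.rootNumber * uτ * u₁ with hεdef
  have hε : ε = 1 ∨ ε = -1 := by
    rcases WeierstrassCurve.rootNumber_eq_one_or E' with h1 | h1 <;> rcases huτ with h2 | h2 <;>
      rcases hu₁ with h3 | h3 <;> simp [hεdef, h1, h2, h3]
  -- §3 the roots `ϑ_m = χ(m)·θ↑`
  have h1m : ∀ m : ℕ, m ≠ 0 → ringClassField K ι 1 ≤ ringClassField K ι m :=
    fun m hm => ringClassField_mono hK ι (one_dvd m) hm
  obtain ⟨χ, hχdef⟩ : ∃ χ : ℕ → ℤ, ∀ m, χ m = if jacobiSym d₁ m = -1 then -1 else 1 := ⟨_, fun _ => rfl⟩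
  have hχ : ∀ m, χ m = 1 ∨ χ m = -1 := fun m => by rw [hχdef]; exact levelSign_eq_one_or d₁ m
  obtain ⟨ϑ, hϑdef⟩ : ∃ ϑ : (m : ℕ) → m ≠ 0 → ringClassField K ι m, ∀ m (hm : m ≠ 0),
      ϑ m hm = ((χ m : ℤ) : ringClassField K ι m) * RingClassField.inclusion ι (h1m m hm) θ :=
    ⟨fun m hm => ((χ m : ℤ) : ringClassField K ι m) * RingClassField.inclusion ι (h1m m hm) θ, fun _ _ => rfl⟩
  have hϑ2 : ∀ m (hm : m ≠ 0), ϑ m hm ^ 2 = algebraMap ℚ (ringClassField K ι m) (d₁ : ℚ) :=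
    fun m hm => root_sq_eq ι (h1m m hm) (hχ m) hθ2 (hϑdef m hm)
  have hϑ0 : ∀ m (hm : m ≠ 0), ϑ m hm ≠ 0 := fun m hm => root_ne_zero ι (h1m m hm) (hχ m) hθ0 (hϑdef m hm)
  have hϑC : ∀ m (hm : m ≠ 0), (ϑ m hm : ℂ) = ((χ m : ℤ) : ℂ) * (θ : ℂ) :=
    fun m hm => coe_root ι (h1m m hm) (hϑdef m hm)
  -- §4 the bare family
  obtain ⟨Y, hYdef⟩ : ∃ Y : (m : ℕ) → ((C₂ • (D • E').quadraticTwist (d₁ : ℚ)).baseChange (ringClassField K ι m)).toAffine.Point,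
      ∀ m, Y m = if hm : m ≠ 0 then (VariableChange.pointEquivBaseChange ((D • E').quadraticTwist (d₁ : ℚ)) C₂ (ringClassField K ι m)
          ((VariableChange.pointEquiv (((D • E').quadraticTwist (d₁ : ℚ)).baseChange (ringClassField K ι m)) (untwistAt (hϑ0 m hm))).symm
            ((Affine.Point.congrEquiv (untwistAt_smul_eq (D • E') (hϑ2 m hm) (hϑ0 m hm))).symm
              (VariableChange.pointEquivBaseChange E' D (ringClassField K ι m) (yE m))))) else 0 :=
    ⟨fun m => if hm : m ≠ 0 then (VariableChange.pointEquivBaseChange ((D • E').quadraticTwist (d₁ : ℚ)) C₂ (ringClassField K ι m)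
          ((VariableChange.pointEquiv (((D • E').quadraticTwist (d₁ : ℚ)).baseChange (ringClassField K ι m)) (untwistAt (hϑ0 m hm))).symm
            ((Affine.Point.congrEquiv (untwistAt_smul_eq (D • E') (hϑ2 m hm) (hϑ0 m hm))).symm
              (VariableChange.pointEquivBaseChange E' D (ringClassField K ι m) (yE m))))) else 0, fun _ => rfl⟩
  have hY : ∀ m (hm : m ≠ 0), Y m = (VariableChange.pointEquivBaseChange ((D • E').quadraticTwist (d₁ : ℚ)) C₂ (ringClassField K ι m)
          ((VariableChange.pointEquiv (((D • E').quadraticTwist (d₁ : ℚ)).baseChange (ringClassField K ι m)) (untwistAt (hϑ0 m hm))).symm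
            ((Affine.Point.congrEquiv (untwistAt_smul_eq (D • E') (hϑ2 m hm) (hϑ0 m hm))).symm
              (VariableChange.pointEquivBaseChange E' D (ringClassField K ι m) (yE m))))) := fun m hm => by
    rw [hYdef m, dif_pos hm]
  -- §5 level bookkeeping from the UNGUARDED level condition (every prime factor inert and prime to `N_W`)
  have hlev : ∀ {m : ℕ}, Squarefree m →
      (∀ q ∈ m.primeFactors, ¬ q ∣ (C₂ • (D • E').quadraticTwist (d₁ : ℚ)).conductorNorm ℤ ∧
        (Ideal.span {(q : 𝓞 K)}).IsPrime) →
      m.Coprime (E'.conductorNorm ℤ) ∧ d₁.gcd m = 1 ∧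
      ∀ ℓ ∈ m.primeFactors, ℓ ≠ 2 ∧ (Ideal.span {(ℓ : 𝓞 K)}).IsPrime ∧ ¬ (ℓ : ℤ) ∣ d₁ ∧
        ¬ ℓ ∣ (C₂ • (D • E').quadraticTwist (d₁ : ℚ)).conductorNorm ℤ := by
    intro m hm hgd
    have hm0 : m ≠ 0 := hm.ne_zero
    have hfacts : ∀ ℓ ∈ m.primeFactors, ℓ ≠ 2 ∧ (Ideal.span {(ℓ : 𝓞 K)}).IsPrime ∧ ¬ (ℓ : ℤ) ∣ d₁ ∧
        ¬ ℓ ∣ (C₂ • (D • E').quadraticTwist (d₁ : ℚ)).conductorNorm ℤ := by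
      intro ℓ hℓ
      have hℓp : ℓ.Prime := Nat.prime_of_mem_primeFactors hℓ
      obtain ⟨hℓW, hinert⟩ := hgd ℓ hℓ
      have hℓ2 : ℓ ≠ 2 := h2 ℓ hℓp hinert hℓW
      exact ⟨hℓ2, hinert, fun h => not_dvd_discr_of_isPrime_span hK.1 hℓp hℓ2 hinert (h.trans hd₁), hℓW⟩
    refine ⟨?_, ?_, hfacts⟩
    · refine (ModularAuxNorm.coprime_of_forall_primeFactors_not_dvd hm0 fun r hr hrN => ?_).symm
      obtain ⟨hr2, -, hrd, hrW⟩ := hfacts r hr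
      haveI : Fact r.Prime := ⟨Nat.prime_of_mem_primeFactors hr⟩
      have hgoodW : (C₂ • (D • E').quadraticTwist (d₁ : ℚ)).HasGoodReductionAtPrime r :=
        not_not.mp (mt ((C₂ • (D • E').quadraticTwist (d₁ : ℚ)).dvd_conductorNorm_iff_not_hasGoodReductionAtPrime r).mpr hrW)
      have hgoodE := hasGoodReductionAtPrime_of_twist_presentation (C₂ • (D • E').quadraticTwist (d₁ : ℚ)) E' hE' hr2 hrd hgoodW
      exact (E'.dvd_conductorNorm_iff_not_hasGoodReductionAtPrime r).mp hrN hgoodE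
    · have hc : Nat.Coprime d₁.natAbs m :=
        ModularAuxNorm.coprime_of_forall_primeFactors_not_dvd (N := d₁.natAbs) hm0 fun r hr hrd =>
          (hfacts r hr).2.2.1 (Int.ofNat_dvd_left.mpr hrd)
      exact hc
  -- §6 label (B3) at every level `m ≠ 0`
  have hB3all : ∀ (m : ℕ), m ≠ 0 → ∀ τm : ringClassField K ι m ≃ₐ[ℚ] ringClassField K ι m,
      (∀ x : ringClassField K ι m, ((τm x : ringClassField K ι m) : ℂ) = conj (x : ℂ)) →
      ∃ σ' ∈ ringClassGal ι m, IsOfFinAddOrder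
        (pointGalHom (C₂ • (D • E').quadraticTwist (d₁ : ℚ)) (ringClassField K ι m) τm (Y m) - ε • pointGalHom (C₂ • (D • E').quadraticTwist (d₁ : ℚ)) (ringClassField K ι m) σ' (Y m)) := by
    intro m hm0 τm hτm
    by_cases hgood : m ≠ 0 ∧ m.Coprime (E'.conductorNorm ℤ)
    · obtain ⟨σ', hσ', hpin, hfin⟩ := H53 m hm0 hgood.2 (yE m) (hyE m hm0 hgood.2) τm hτm
      refine ⟨σ', hσ', ?_⟩
      rw [hY m hm0]
      exact label_B3_level ι E' D C₂ d₁ (hϑ2 m hm0) (hϑ0 m hm0) huτ hu₁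
        (apply_root_eq_of_conj ι hθ2 hθ0 (hϑC m hm0) τm hτm)
        (apply_root_eq_of_pinned ι (hϑC m hm0) hpin hσ₁θ) hfin
    · refine ⟨1, one_mem _, ?_⟩
      rw [hY m hm0, hyE0 m hgood]
      simp only [map_zero, smul_zero, sub_zero]
      exact IsOfFinAddOrder.zero
  -- §7 label (B2)
  have hyE1 : yE 1 = y := by
    apply Affine.Point.map_injective (f := (ringClassField K ι 1).subtype.toRatAlgHom)
    rw [hyE 1 one_ne_zero (Nat.coprime_one_left (E'.conductorNorm ℤ)), hy]
  have hϑ1 : ϑ 1 one_ne_zero = θ := by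
    apply Subtype.ext
    rw [hϑC 1 one_ne_zero]
    have : χ 1 = 1 := by rw [hχdef]; simp [jacobiSym.one_right]
    rw [this]; push_cast; ring
  have hB2 : ∀ T : Finset (ringClassField K ι 1 ≃ₐ[ℚ] ringClassField K ι 1),
      (∀ g, g ∈ T ↔ g ∈ ringClassGal ι 1) →
      Affine.Point.map (algebraMap K (ringClassField K ι 1)).toRatAlgHom P =
        ∑ g ∈ T, pointGalHom (C₂ • (D • E').quadraticTwist (d₁ : ℚ)) (ringClassField K ι 1) g (Y 1) := by
    intro T hT
    rw [hY 1 one_ne_zero, hyE1, twist_congr E' D C₂ d₁ (hϑ2 1 one_ne_zero) (hϑ0 1 one_ne_zero) hθ2 hθ0 hϑ1,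
      hP, Finset.sum_subtype T hT (fun g => pointGalHom (C₂ • (D • E').quadraticTwist (d₁ : ℚ)) (ringClassField K ι 1) g (VariableChange.pointEquivBaseChange ((D • E').quadraticTwist (d₁ : ℚ)) C₂ (ringClassField K ι 1)
          ((VariableChange.pointEquiv (((D • E').quadraticTwist (d₁ : ℚ)).baseChange (ringClassField K ι 1)) (untwistAt hθ0)).symm
            ((Affine.Point.congrEquiv (untwistAt_smul_eq (D • E') hθ2 hθ0)).symm
              (VariableChange.pointEquivBaseChange E' D (ringClassField K ι 1) y)))))]
    have key := twist_sum_smul_pointGalHom' E' D C₂ (d₁ : ℚ) hθ2 hθ0 (Finset.univ : Finset (ringClassGal ι 1))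
      (fun τ => τ.1) (fun τ => (s τ : ℤ)) (fun τ _ => by
        rcases Int.units_eq_one_or (s τ) with h | h
        · left; rw [h]; rfl
        · right; rw [h]; rfl) (fun τ _ => hθσ τ) y
    exact key
  -- §8 label (B3₀)
  have hB3K := ShimuraKolyvaginConjKLevel.isOfFinAddOrder_map_sub_smul_of_labels hK ι Y hB2 hB3all
  -- §9 labels (B4), (B5) at every UNGUARDED level, and the assembly of `LabelsAt`
  have hB4 : ∀ m : ℕ, Squarefree m →
      (∀ q ∈ m.primeFactors, ¬ q ∣ (C₂ • (D • E').quadraticTwist (d₁ : ℚ)).conductorNorm ℤ ∧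
        (Ideal.span {(q : 𝓞 K)}).IsPrime) →
      ∀ (ℓ : ℕ) (_ : ℓ ∈ m.primeFactors) (hle : ringClassField K ι (m / ℓ) ≤ ringClassField K ι m)
        (σ : ringClassField K ι m ≃ₐ[ℚ] ringClassField K ι m),
        Subgroup.zpowers σ = ringClassGalOver ι m (m / ℓ) →
        letI : Algebra K ℂ := ι.toAlgebra
        ∑ i ∈ Finset.range (ℓ + 1), pointGalHom (C₂ • (D • E').quadraticTwist (d₁ : ℚ)) (ringClassField K ι m) (σ ^ i) (Y m) =
          (C₂ • (D • E').quadraticTwist (d₁ : ℚ)).frobeniusTrace ℓ • WeierstrassCurve.Affine.Point.map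
            (W' := (C₂ • (D • E').quadraticTwist (d₁ : ℚ)))
            ((RingClassField.inclusion ι hle).restrictScalars ℚ) (Y (m / ℓ)) := by
    intro m hm hgd ℓ hℓm hle σ hσ
    obtain ⟨hmN, hgcd, hfacts⟩ := hlev hm hgd
    obtain ⟨hℓ2, hinert, hℓd, hℓW⟩ := hfacts ℓ hℓm
    have hℓ : ℓ.Prime := Nat.prime_of_mem_primeFactors hℓm
    haveI : Fact ℓ.Prime := ⟨hℓ⟩
    have hm0 : m ≠ 0 := hm.ne_zero
    have hℓdvd : ℓ ∣ m := Nat.dvd_of_mem_primeFactors hℓm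
    have hm'0 : m / ℓ ≠ 0 := fun h => hm0 (by
      rw [← Nat.mul_div_cancel' hℓdvd, h, mul_zero])
    have hm'N : (m / ℓ).Coprime (E'.conductorNorm ℤ) := Nat.Coprime.coprime_dvd_left (Nat.div_dvd_of_dvd hℓdvd) hmN
    have hgoodW : (C₂ • (D • E').quadraticTwist (d₁ : ℚ)).HasGoodReductionAtPrime ℓ :=
      not_not.mp (mt ((C₂ • (D • E').quadraticTwist (d₁ : ℚ)).dvd_conductorNorm_iff_not_hasGoodReductionAtPrime ℓ).mpr hℓW)
    have hgoodE := hasGoodReductionAtPrime_of_twist_presentation (C₂ • (D • E').quadraticTwist (d₁ : ℚ)) E' hE' hℓ2 hℓd hgoodW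
    have hϑϑ' : (ϑ m hm0 : ℂ) = (legendreSym ℓ d₁ : ℂ) * (ϑ (m / ℓ) hm'0 : ℂ) := by
      rw [hϑC m hm0, hϑC (m / ℓ) hm'0, ← mul_assoc]
      congr 1
      rw [hχdef m, hχdef (m / ℓ)]
      exact_mod_cast levelSign_eq_legendreSym_mul hℓdvd hm0 hgcd
    rw [hY m hm0, hY (m / ℓ) hm'0]
    exact label_B4_level hK ι hD4 E' D C₂ d₁ Dt hβ hm hℓm hℓ2 hinert hℓd hgoodW hgoodE hmN hle σ hσ
      (hϑ2 m hm0) (hϑ0 m hm0) (hϑ2 (m / ℓ) hm'0) (hϑ0 (m / ℓ) hm'0) hϑϑ' (hyE m hm0 hmN)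
      (hyE (m / ℓ) hm'0 hm'N)
  have hB5 : ∀ m : ℕ, Squarefree m →
      (∀ q ∈ m.primeFactors, ¬ q ∣ (C₂ • (D • E').quadraticTwist (d₁ : ℚ)).conductorNorm ℤ ∧
        (Ideal.span {(q : 𝓞 K)}).IsPrime) →
      ∀ (ℓ : ℕ) (_ : ℓ ∈ m.primeFactors) [Fact ℓ.Prime]
        (hΔ : ¬ (ℓ : ℤ) ∣ minimalDiscriminantInt (C₂ • (D • E').quadraticTwist (d₁ : ℚ)))
        (φ₀ : absoluteGaloisGroup (ZMod ℓ)), (∀ x : AlgebraicClosure (ZMod ℓ), φ₀ • x = x ^ ℓ) →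
      ∀ (hle : ringClassField K ι (m / ℓ) ≤ ringClassField K ι m)
        (emb : ringClassField K ι m →+* AlgebraicClosure K),
        (∀ x : K, emb (algebraMap K (ringClassField K ι m) x) = algebraMap K (AlgebraicClosure K) x) →
      ∀ (j : ((C₂ • (D • E').quadraticTwist (d₁ : ℚ)).baseChange (ringClassField K ι m)).toAffine.Point →+
          geomPoints ((C₂ • (D • E').quadraticTwist (d₁ : ℚ)).baseChange K)),
        j = WeierstrassCurve.Affine.Point.map (W' := (C₂ • (D • E').quadraticTwist (d₁ : ℚ))) emb.toRatAlgHom →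
      ∀ γ : ringClassField K ι m ≃ₐ[ℚ] ringClassField K ι m, γ ∈ ringClassGal ι m →
        letI : Algebra K ℂ := ι.toAlgebra
        geomReduction hΔ ((RatClosure.pointsEquiv (K := K) (C₂ • (D • E').quadraticTwist (d₁ : ℚ))).symm
            (j (pointGalHom (C₂ • (D • E').quadraticTwist (d₁ : ℚ)) (ringClassField K ι m) γ (Y m)))) =
          φ₀ • geomReduction hΔ ((RatClosure.pointsEquiv (K := K) (C₂ • (D • E').quadraticTwist (d₁ : ℚ))).symm
            (j (pointGalHom (C₂ • (D • E').quadraticTwist (d₁ : ℚ)) (ringClassField K ι m) γ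
              (WeierstrassCurve.Affine.Point.map (W' := (C₂ • (D • E').quadraticTwist (d₁ : ℚ)))
                ((RingClassField.inclusion ι hle).restrictScalars ℚ) (Y (m / ℓ)))))) := by
    intro m hm hgd ℓ hℓm _ hΔ φ₀ hφ₀ hle emb hemb j hj γ _
    obtain ⟨hmN, hgcd, hfacts⟩ := hlev hm hgd
    obtain ⟨hℓ2, hinert, hℓd, hℓW⟩ := hfacts ℓ hℓm
    have hℓ : ℓ.Prime := Nat.prime_of_mem_primeFactors hℓm
    have hm0 : m ≠ 0 := hm.ne_zero
    have hℓdvd : ℓ ∣ m := Nat.dvd_of_mem_primeFactors hℓm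
    have hm'0 : m / ℓ ≠ 0 := fun h => hm0 (by
      rw [← Nat.mul_div_cancel' hℓdvd, h, mul_zero])
    have hm'N : (m / ℓ).Coprime (E'.conductorNorm ℤ) := Nat.Coprime.coprime_dvd_left (Nat.div_dvd_of_dvd hℓdvd) hmN
    have hgoodW : (C₂ • (D • E').quadraticTwist (d₁ : ℚ)).HasGoodReductionAtPrime ℓ :=
      not_not.mp (mt ((C₂ • (D • E').quadraticTwist (d₁ : ℚ)).dvd_conductorNorm_iff_not_hasGoodReductionAtPrime ℓ).mpr hℓW)
    have hgoodE := hasGoodReductionAtPrime_of_twist_presentation (C₂ • (D • E').quadraticTwist (d₁ : ℚ)) E' hE' hℓ2 hℓd hgoodW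
    have hϑϑ' : (ϑ m hm0 : ℂ) = (legendreSym ℓ d₁ : ℂ) * (ϑ (m / ℓ) hm'0 : ℂ) := by
      rw [hϑC m hm0, hϑC (m / ℓ) hm'0, ← mul_assoc]
      congr 1
      rw [hχdef m, hχdef (m / ℓ)]
      exact_mod_cast levelSign_eq_legendreSym_mul hℓdvd hm0 hgcd
    rw [hY m hm0, hY (m / ℓ) hm'0]
    exact label_B5_level hNek hK ι E' D C₂ d₁ Dt hβ hm hℓm hℓ2 hinert hℓd hgoodE hmN hΔ hle
      (hϑ2 m hm0) (hϑ0 m hm0) (hϑ2 (m / ℓ) hm'0) (hϑ0 (m / ℓ) hm'0) hϑϑ' (hyE m hm0 hmN)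
      (hyE (m / ℓ) hm'0 hm'N) hφ₀ emb j hj γ
  refine ⟨Y, ε, ⟨hε, hB2, hB3all, hB3K, hB4, hB5⟩, ?_⟩
  -- §10 the identification: a CM point at level `c` transported along ANY root `ϑ'` of `d₁` is `± Y c`
  intro c hc hcN ϑ' hϑ'2 hϑ'0 y' hy'
  have hyc : y' = yE c := by
    apply Affine.Point.map_injective (f := (ringClassField K ι c).subtype.toRatAlgHom)
    rw [hy', hyE c hc hcN]
  rw [hyc, hY c hc]
  exact genusTransport_eq_or_eq_neg E' D C₂ d₁ (hϑ2 c hc) (hϑ0 c hc) hϑ'2 hϑ'0 (yE c)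

end Summit.BirchSwinnertonDyer.BirchSwinnertonDyer.Theorems.GenusLine

end
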